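import Summits.NavierStokesRegularity.OSWSelfSimilar.SheetRPerturbedResolventC
import HarnessLib

/-!
# SHEET-ℝ frame, Z3-SR-SPEC S2: the CONJUGATION SYMMETRY of the perturbed resolvent — `R_K(σ̄)` on real data is the conjugate
# of `R_K(σ)`, hence `⟪h, R_K(σ̄) f⟫ = conj ⟪h, R_K(σ) f⟫` and `E(σ̄) = conj E(σ)` for real `h, f, θ`

HONEST FRAMING (cell ns-blowup GROUP B / zone Z3, case Z3-SR-SPEC, step (S2): implementation 2 computes the left edge of the rectangle only
for `Im σ ≥ 0` and certifies the lower half «by the exact conjugation symmetry `E(σ̄) = conj E(σ)` of the real operator» — this file is that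
sentence in the kernel; 1-D MODEL certificate frame (viscous gCLM/OSW sheet on the line); not Euler/NS; «violates: none — MODEL»). Nothing here
is interval arithmetic and nothing asserts a profile or a zero exists; the Gårding datum `GardingDataKC` is the HYPOTHESIS, `K` arbitrary.
CONTENT (selfsim's architecture, proof pattern of `SheetRPerturbedResolventC.pairOpKC_rot`): the weak pair system with data `(g_R, −g_I)` at
`σ̄` is solved by `(p_R, −p_I)` where `(p_R, p_I)` solves it with data `(g_R, g_I)` at `σ` (`pairOpKC_conj`, uniqueness); hence
`resolventKC σ̄ (ofPair (g_R, −g_I)) = ofRealW(ιE p_R) − i·ofRealW(ιE p_I)` (`resolventKC_conj_ofPair`); inner products of real elements of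
`L²_w(ℂ)` are real (`inner_ofRealW_conj`); so for REAL `h = ofRealW h_r`, `f = ofRealW f_r`:
`⟪h, resolventKC σ̄ f⟫ = conj ⟪h, resolventKC σ f⟫` (`inner_resolventKC_conj`) and, for real `θ`, the Evans-type function
`E(w) = 1 − θ⟪h, resolventKC w f⟫` satisfies `E(w̄) = conj E(w)` (`evans_resolventKC_conj`) — the hypothesis `hsym` of
`SheetRSpectrumPointCertificate.rectLabelCertificate_of_pointData`. Pure functional analysis; no definition, no named fact.
WHAT THIS IS NOT: not NS; not the certificate; no number of record moves.
-/

noncomputable section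

namespace Summit.NavierStokesRegularity.OSWSelfSimilar
namespace SheetRResolventConj

open _root_.MeasureTheory _root_.Set _root_.Filter _root_.Real SheetRWeakProfilePV SheetRWeakToStrong SheetREnergyClass SheetRWeightedMeasure
  SheetRLinearisedTests SheetREnergySpace SheetRTestSpace SheetRLinearisedFormBounds SheetRSolutionOperator SheetRLinearisedCutoffEnergy
  SheetRResolventPair SheetRComplexPivot SheetRResolventComplex SheetRPerturbedUniqueness SheetRPerturbedPair SheetRPerturbedResolventC
open scoped Topology ENNReal ComplexConjugate InnerProductSpace

variable {L D₀ D₁ V₀ c m : ℝ} {d V : ℝ → ℝ} {hL : 0 < L} {K : Esp L hL →L[ℝ] W L}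

/-- `σ̄` has the same real part, so the same half-plane condition. [folklore] -/
theorem re_conj_gt {σ : ℂ} (hσ : -m < σ.re) : -m < (conj σ).re := by
  rwa [Complex.conj_re]

/-- **Conjugation of the pair solution operator**: `pairOpKC σ̄ (g_R, −g_I) = (p_R, −p_I)` where `(p_R, p_I) = pairOpKC σ (g_R, g_I)` —
the realified form of «the operator has real coefficients». [folklore] -/
theorem pairOpKC_conj (h : GardingDataKC L hL d V K D₀ D₁ V₀ c m) (σ : ℂ) (hσ : -m < σ.re) (G : WithLp 2 (W L × W L)) :
    pairOpKC hL K h (conj σ) (re_conj_gt hσ) (WithLp.toLp 2 (G.fst, -G.snd)) =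
      WithLp.toLp 2 ((pairOpKC hL K h σ hσ G).fst, -(pairOpKC hL K h σ hσ G).snd) := by
  set Q := pairOpKC hL K h σ hσ G with hQdef
  have hQ := (pairOpKC_spec hL K h σ hσ).1 G
  symm
  refine pairOpKC_unique hL K h (conj σ) (re_conj_gt hσ) _ fun v v₁ hv => ?_
  obtain ⟨e1, e2⟩ := hQ v v₁ hv
  have hR1 : (WithLp.toLp 2 (Q.fst, -Q.snd) : WithLp 2 (Esp L hL × Esp L hL)).fst = Q.fst := rfl
  have hR2 : (WithLp.toLp 2 (Q.fst, -Q.snd) : WithLp 2 (Esp L hL × Esp L hL)).snd = -Q.snd := rfl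
  have hD1 : (WithLp.toLp 2 (G.fst, -G.snd) : WithLp 2 (W L × W L)).fst = G.fst := rfl
  have hD2 : (WithLp.toLp 2 (G.fst, -G.snd) : WithLp 2 (W L × W L)).snd = -G.snd := rfl
  rw [hR1, hR2, hD1, hD2, Complex.conj_re, Complex.conj_im]
  obtain ⟨hneg_ae, hneg_prim⟩ := der_neg hL Q.snd
  have hlin : linForm L d (fun ξ => V ξ + σ.re) (prim (der (-Q.snd))) (der (-Q.snd)) v v₁ =
      -1 * linForm L d (fun ξ => V ξ + σ.re) (prim (der Q.snd)) (der Q.snd) v v₁ := by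
    rw [linForm_congr_ae L d _ (Eventually.of_forall fun y => congrFun hneg_prim y) hneg_ae]
    exact linForm_smul_left L d _ (-1)
  have hcpl : ∫ y, (L ^ 2 + y ^ 2) * (prim (der (-Q.snd)) y * v y) = -1 * ∫ y, (L ^ 2 + y ^ 2) * (prim (der Q.snd) y * v y) := by
    rw [← integral_const_mul]
    refine integral_congr_ae (Eventually.of_forall fun y => ?_)
    show (L ^ 2 + y ^ 2) * (prim (der (-Q.snd)) y * v y) = -1 * ((L ^ 2 + y ^ 2) * (prim (der Q.snd) y * v y))
    rw [congrFun hneg_prim y]; ring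
  have hdat : ∫ y, (L ^ 2 + y ^ 2) * ((((-G.snd : W L)) : ℝ → ℝ) y * v y) = -1 * ∫ y, (L ^ 2 + y ^ 2) * ((G.snd : ℝ → ℝ) y * v y) := by
    rw [← integral_const_mul]
    refine integral_congr_ae ((ae_volume_of_ae_μw hL (Lp.coeFn_neg (G.snd : W L))).mono fun y hy => ?_)
    show (L ^ 2 + y ^ 2) * (((-G.snd : W L) : ℝ → ℝ) y * v y) = -1 * ((L ^ 2 + y ^ 2) * ((G.snd : ℝ → ℝ) y * v y))
    rw [hy, Pi.neg_apply]; ring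
  have hK : ∫ y, (L ^ 2 + y ^ 2) * (((K (-Q.snd) : W L) : ℝ → ℝ) y * v y) = -1 * ∫ y, (L ^ 2 + y ^ 2) * (((K Q.snd : W L) : ℝ → ℝ) y * v y) := by
    rw [← integral_const_mul, map_neg K]
    refine integral_congr_ae ((ae_volume_of_ae_μw hL (Lp.coeFn_neg (K Q.snd : W L))).mono fun y hy => ?_)
    show (L ^ 2 + y ^ 2) * (((-(K Q.snd) : W L) : ℝ → ℝ) y * v y) = -1 * ((L ^ 2 + y ^ 2) * (((K Q.snd : W L) : ℝ → ℝ) y * v y))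
    rw [hy, Pi.neg_apply]; ring
  refine ⟨?_, ?_⟩
  · rw [hcpl]; linarith
  · rw [hlin, hK, hdat]; linarith

/-- `toPair (ofRealW g) = (g, 0)`: a real element has real-pair coordinates `(g, 0)`. [folklore] -/
theorem toPair_ofRealW (g : W L) : toPair L (ofRealW L g) = WithLp.toLp 2 (g, 0) := by
  have e : ofRealW L g = ofPair L (WithLp.toLp 2 (g, 0)) := by
    rw [ofPair_apply]
    show ofRealW L g = ofRealW L g + (Complex.I : ℂ) • ofRealW L 0
    rw [map_zero, smul_zero, add_zero]
  rw [e, toPair_ofPair]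

/-- A purely real element: `Im G = 0 ⇒ G = ofRealW (Re G)`. [folklore] -/
theorem eq_ofRealW_of_imW_eq_zero {G : Wc L} (hG : imW L G = 0) : G = ofRealW L (reW L G) := by
  conv_lhs => rw [← ofPair_toPair G]
  rw [ofPair_apply, (toPair_fst_snd G).1, (toPair_fst_snd G).2, hG, map_zero, smul_zero, add_zero]

/-- **The resolvent of real data at `σ` and at `σ̄`**: `R_K(σ)(g) = ιE p_R + i·ιE p_I` and `R_K(σ̄)(g) = ιE p_R − i·ιE p_I` with
`(p_R, p_I) = pairOpKC σ (g, 0)`. [folklore] -/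
theorem resolventKC_conj_real (h : GardingDataKC L hL d V K D₀ D₁ V₀ c m) {σ : ℂ} (hσ : -m < σ.re) (g : W L) :
    resolventKC hL K h σ (ofRealW L g) =
        ofRealW L (ιE hL (pairOpKC hL K h σ hσ (WithLp.toLp 2 (g, 0))).fst)
          + (Complex.I : ℂ) • ofRealW L (ιE hL (pairOpKC hL K h σ hσ (WithLp.toLp 2 (g, 0))).snd) ∧
      resolventKC hL K h (conj σ) (ofRealW L g) =
        ofRealW L (ιE hL (pairOpKC hL K h σ hσ (WithLp.toLp 2 (g, 0))).fst)
          - (Complex.I : ℂ) • ofRealW L (ιE hL (pairOpKC hL K h σ hσ (WithLp.toLp 2 (g, 0))).snd) := by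
  set Q := pairOpKC hL K h σ hσ (WithLp.toLp 2 (g, 0)) with hQ
  refine ⟨?_, ?_⟩
  · obtain ⟨h1, -, -, -⟩ := resolventKC_weak hL K h hσ (ofRealW L g)
    rw [h1, toPair_ofRealW, ofPair_apply, (ιpair_fst_snd hL Q).1, (ιpair_fst_snd hL Q).2]
  · obtain ⟨h1, -, -, -⟩ := resolventKC_weak hL K h (re_conj_gt hσ) (ofRealW L g)
    have hdata : (WithLp.toLp 2 (g, 0) : WithLp 2 (W L × W L)) =
        WithLp.toLp 2 ((WithLp.toLp 2 (g, 0) : WithLp 2 (W L × W L)).fst, -(WithLp.toLp 2 (g, 0) : WithLp 2 (W L × W L)).snd) := by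
      show (WithLp.toLp 2 (g, 0) : WithLp 2 (W L × W L)) = WithLp.toLp 2 (g, -0)
      rw [neg_zero]
    rw [h1, toPair_ofRealW, hdata, pairOpKC_conj h σ hσ, ofPair_apply, ← hQ]
    have hf : (ιpair hL (WithLp.toLp 2 (Q.fst, -Q.snd))).fst = ιE hL Q.fst := (ιpair_fst_snd hL _).1
    have hs : (ιpair hL (WithLp.toLp 2 (Q.fst, -Q.snd))).snd = ιE hL (-Q.snd) := (ιpair_fst_snd hL _).2
    rw [hf, hs, map_neg, map_neg, smul_neg, sub_eq_add_neg]

/-- Inner products of real elements of `L²_w(ℂ)` are real. [folklore] -/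
theorem conj_inner_ofRealW (a b : W L) : conj ⟪ofRealW L a, ofRealW L b⟫_ℂ = ⟪ofRealW L a, ofRealW L b⟫_ℂ := by
  rw [MeasureTheory.L2.inner_def, ← integral_conj]
  refine integral_congr_ae ?_
  filter_upwards [ofRealW_ae a, ofRealW_ae b] with y ha hb
  rw [ha, hb]
  simp only [RCLike.inner_apply, map_mul, Complex.conj_ofReal]

/-- **THE CONJUGATION SYMMETRY**: for real `h = ofRealW a`, `f = ofRealW g` and every `σ ∈ ℂ` (inside or outside the half-plane),
`⟪h, R_K(σ̄) f⟫ = conj ⟪h, R_K(σ) f⟫`. [folklore] -/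
theorem inner_resolventKC_conj (h : GardingDataKC L hL d V K D₀ D₁ V₀ c m) (a g : W L) (σ : ℂ) :
    ⟪ofRealW L a, resolventKC hL K h (conj σ) (ofRealW L g)⟫_ℂ = conj ⟪ofRealW L a, resolventKC hL K h σ (ofRealW L g)⟫_ℂ := by
  by_cases hσ : -m < σ.re
  · obtain ⟨h1, h2⟩ := resolventKC_conj_real h hσ g
    rw [h1, h2, inner_sub_right, inner_add_right, inner_smul_right, map_add, map_mul, Complex.conj_I,
      conj_inner_ofRealW, conj_inner_ofRealW]
    ring
  · have hσ' : ¬ -m < (conj σ).re := by rwa [Complex.conj_re]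
    rw [resolventKC_apply, resolventKC_apply, resolventRKC_of_not hL K h hσ, resolventRKC_of_not hL K h hσ']
    simp

/-- **`E(σ̄) = conj E(σ)`** for the Evans-type function `E(w) = 1 − θ⟪h, R_K(w) f⟫` with real `h, f` and real `θ` — the hypothesis `hsym` of
`SheetRSpectrumPointCertificate.rectLabelCertificate_of_pointData`. [folklore] -/
theorem evans_resolventKC_conj (h : GardingDataKC L hL d V K D₀ D₁ V₀ c m) (a g : W L) (θ : ℝ) {E : ℂ → ℂ}
    (hE : ∀ w, E w = 1 - (θ : ℂ) * ⟪ofRealW L a, resolventKC hL K h w (ofRealW L g)⟫_ℂ) (w : ℂ) :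
    E (conj w) = conj (E w) := by
  rw [hE, hE, inner_resolventKC_conj, map_sub, map_one, map_mul, Complex.conj_ofReal]

/-- The same with the realness of `h, f` stated as `Im h = 0`, `Im f = 0`. [folklore] -/
theorem evans_resolventKC_conj' (h : GardingDataKC L hL d V K D₀ D₁ V₀ c m) {hv f : Wc L} (hh : imW L hv = 0) (hf : imW L f = 0)
    (θ : ℝ) {E : ℂ → ℂ} (hE : ∀ w, E w = 1 - (θ : ℂ) * ⟪hv, resolventKC hL K h w f⟫_ℂ) (w : ℂ) :
    E (conj w) = conj (E w) := by
  have e1 := eq_ofRealW_of_imW_eq_zero hh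
  have e2 := eq_ofRealW_of_imW_eq_zero hf
  refine evans_resolventKC_conj h (reW L hv) (reW L f) θ (fun w' => ?_) w
  rw [hE w', ← e1, ← e2]

end SheetRResolventConj
end Summit.NavierStokesRegularity.OSWSelfSimilar

end
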